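import Literature.AlgebraicGeometry.HodgeTheory.AbelianVarietyHodgeFullnessHolds
import Literature.AlgebraicGeometry.Deligne1982.HodgeGroupCommutantHOne
import HarnessLib

/-!
# Deligne I Prop. 3.4 / 5.1 on `H¹`: the commutant of the Hodge group of a complex abelian variety
# is spanned by its endomorphisms — UNCONDITIONALLY

Family `hodge`, layer `Literature/AlgebraicGeometry/Deligne1982`. One theorem; no definition, no
named fact. The tree's `mem_span_complexBetti_map_of_commute_hodgeGroup_of_riemann`
(`HodgeGroupCommutantHOne.lean`: [Deligne1982HodgeCycles] I Prop. 3.4 «the elements of `End(V)`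
fixed by `MT(V)` are the endomorphisms of the Hodge structure», combined with Riemann's theorem
[DeligneMilne1982Tannakian] Thm. 6.20 to pass from Hodge endomorphisms of `H¹(A)` to `End(A) ⊗ ℂ`)
carried Riemann's theorem as the hypothesis `hR`; it is now the theorem
`HodgeTheory.deligneMilne1982_Thm_6_20_full_holds`. The resulting statement is the body of ring 2's
`Ring2Transport.HodgeGroupH1CommutantSpan`.

## References

* P. Deligne, *Hodge cycles on abelian varieties*, LNM 900 (1982), I Prop. 3.4, Prop. 5.1.
  [Deligne1982HodgeCycles]
* P. Deligne, J. S. Milne, *Tannakian categories*, LNM 900 (1982), Thm. 6.20. [DeligneMilne1982Tannakian]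
-/

noncomputable section

namespace Literature.AlgebraicGeometry.Deligne1982

open CategoryTheory
open Literature.AlgebraicGeometry.HodgeTheory Literature.AlgebraicGeometry.Motives

/-- **[Deligne1982HodgeCycles] I Prop. 3.4 read on `H¹` of a complex abelian variety, with Riemann's
theorem: a `ℂ`-linear endomorphism of `H¹(A(ℂ); ℂ)` commuting with the Hodge group lies in the
`ℂ`-span of the pull-backs `φ^*`, `φ ∈ End(A)`** — unconditional form of
`mem_span_complexBetti_map_of_commute_hodgeGroup_of_riemann`.
[cite: Deligne1982HodgeCycles, I Prop. 3.4] [cite: DeligneMilne1982Tannakian, Thm. 6.20] -/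
theorem mem_span_complexBetti_map_of_commute_hodgeGroup
    (A : AbelianVariety ℂ) (x : complexBetti A.X 1 →ₗ[ℂ] complexBetti A.X 1)
    (hx : ∀ g ∈ hodgeGroup A.dim A.X, ∀ y : complexBetti A.X 1, x (g 1 y) = g 1 (x y)) :
    x ∈ Submodule.span ℂ (Set.range fun φ : (A ⟶ A) ↦ (complexBetti.map φ.hom.hom.hom 1).hom) :=
  mem_span_complexBetti_map_of_commute_hodgeGroup_of_riemann deligneMilne1982_Thm_6_20_full_holds
    A x hx

end Literature.AlgebraicGeometry.Deligne1982

end
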